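import Mathlib
import HarnessLib
import Literature.Analysis.FluidPDE.AxisymHouLiVariables
import Literature.Analysis.FluidPDE.NSLocalLerayBackwardUniqueness
import Summits.NavierStokesRegularity.NavierStokesRegularity.Theorems.PoloidalWindowDoorPoloidalWindowRigidityOneSlice

/-!
# K2 `PoloidalWindowRigidity` (stmt-NavierStokesRegularity-19708) — THE VERTICALLY RIGID GERM (Clebsch slope `Λ = 1`,
# shear ratio `μ = 0`): `∂₂v_h = 0` on an open set of ONE slice ⇒ `v ≡ 0`

Cell ns-regularity-ideate, seat nsreg-p7 gen 7 (third worker under the K2 lead ns-poloidal-K2-p1).  Companion of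
`…SymmetryGerms` (the analytic glue of the lead's (R) «finite type» endgame, K2P1-LOCAL-NOTES v1 §6: «K2 ⇐ analyticity +
settled strata + H4b∞ + the degenerate sets {ω = 0}, {Λ ∈ {0,1}}»): the last degenerate slope, `Λ = 1`, where the
pressure-free normal form breaks (`A_qq = ∞`, shear ratio `μ = 1 − 1/Λ = 0`: the horizontal velocity does not vary
with the height).

* `fderiv_vertical_eq_zero_of_horizontal` — kinematics on `ℝ³`: a bounded `C²` divergence-free field whose horizontal
  components have no vertical derivative (`∂₂w₀ = ∂₂w₁ = 0` everywhere) has `∂₂w ≡ 0`.  Indeed `∂₂w₂ = −∂₀w₀ − ∂₁w₁`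
  is itself height-independent (Schwarz), so `w₂` is affine along every vertical line, and boundedness kills the
  slope.
* `eq_zero_of_verticalShear_eq_zero_on_open` — CLASS: if on ONE slice `s < 0` of a profile of the route's Type-I class
  `∂₂v₀ = ∂₂v₁ = 0` on a nonempty open set, then `v ≡ 0`: real-analyticity spreads the germ over the slice, the
  kinematic lemma upgrades it to `∂₂v(s) ≡ 0`, the slice is invariant under vertical translations, and the tree's
  one-slice planar Liouville theorem `eq_zero_of_translate_eq_slice` (N₁) applies.  No poloidality is needed.

WHAT THIS IS NOT: not a claim about Navier–Stokes regularity and not the crux — one more germ-to-stratum lemma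
(bears_on LADDER-NS N0, route PoloidalWindowDoor, crux K2; `--supports` the K2 item).
-/

noncomputable section

-- the summit and its single sub-problem share the name (CONVENTIONS §1), as in every Theorems file
set_option linter.dupNamespace false

namespace Summit.NavierStokesRegularity.NavierStokesRegularity.Theorems.PoloidalWindowDoorPoloidalWindowRigidityVerticalShearGerm

open MeasureTheory Set Function Filter Topology Metric InnerProductSpace
open scoped RealInnerProductSpace
open Literature.Analysis Literature.Analysis.FluidPDE
open Summit.NavierStokesRegularity.NavierStokesRegularity.Theorems.LocalSineTubeDoorProfileAlignedWindowRigidityAncient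
open Summit.NavierStokesRegularity.NavierStokesRegularity.Theorems.PoloidalWindowDoorPoloidalWindowRigidityOneSlice

variable {C : ℝ} {v : ℝ → EuclideanSpace ℝ (Fin 3) → EuclideanSpace ℝ (Fin 3)}

/-! ### one-variable bookkeeping -/

/-- A differentiable scalar function on `ℝ³` whose derivative along `e` vanishes identically is invariant under the
translations along `e`. -/
theorem apply_add_smul_eq_of_fderiv_apply_eq_zero {g : EuclideanSpace ℝ (Fin 3) → ℝ} (hg : Differentiable ℝ g)
    {e : EuclideanSpace ℝ (Fin 3)} (h : ∀ y, fderiv ℝ g y e = 0) (y : EuclideanSpace ℝ (Fin 3)) (l : ℝ) :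
    g (y + l • e) = g y := by
  set φ : ℝ → ℝ := fun l => g (y + l • e) with hφ
  have hline : ∀ l : ℝ, HasDerivAt (fun l : ℝ => y + l • e) e l := fun l => by
    simpa using ((hasDerivAt_id l).smul_const e).const_add y
  have hd : ∀ l, HasDerivAt φ 0 l := by
    intro l
    have h1 := (hg (y + l • e)).hasFDerivAt.comp_hasDerivAt l (hline l)
    rw [h (y + l • e)] at h1
    exact h1
  have hdiff : Differentiable ℝ φ := fun l => (hd l).differentiableAt
  have hconst := is_const_of_deriv_eq_zero hdiff (fun l => (hd l).deriv) l 0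
  simpa [hφ] using hconst

/-- An affine function of one real variable that stays bounded has zero slope. -/
theorem eq_zero_of_abs_add_mul_le {a b B : ℝ} (h : ∀ l : ℝ, |a + l * b| ≤ B) : b = 0 := by
  by_contra hb
  have hB0 : 0 ≤ B := (abs_nonneg _).trans (h 0)
  -- take `l = (B + 1 + |a|) / |b| · sign`: simplest with `l = (2B + 2|a| + 1)/b`
  have h1 := h ((B + |a| + 1) / b)
  rw [div_mul_cancel₀ _ hb] at h1
  have h2 : |a + (B + |a| + 1)| ≥ (B + |a| + 1) - |a| := by
    have := abs_add_le (a + (B + |a| + 1)) (-a)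
    rw [abs_neg, show a + (B + |a| + 1) + -a = B + |a| + 1 by ring, abs_of_nonneg (by positivity)] at this
    linarith
  linarith

/-- A coordinate is bounded by the norm: `|y k| ≤ ‖y‖` on `ℝ³`. -/
theorem abs_apply_le_norm_r3 (y : EuclideanSpace ℝ (Fin 3)) (k : Fin 3) : |y k| ≤ ‖y‖ := by
  have h := EuclideanSpace.norm_sq_eq y
  have hk : |y k| ^ 2 ≤ ∑ j, |y j| ^ 2 :=
    Finset.single_le_sum (f := fun j => |y j| ^ 2) (fun j _ => sq_nonneg _) (Finset.mem_univ k)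
  have h2 : |y k| ^ 2 ≤ ‖y‖ ^ 2 := by
    rw [h]
    simpa using hk
  exact (pow_le_pow_iff_left₀ (abs_nonneg _) (norm_nonneg _) two_ne_zero).1 h2

/-! ### kinematics: vertically rigid horizontal velocity forces vertical rigidity -/

/-- **Kinematics.**  Let `w` be a `C²` divergence-free field on `ℝ³`, bounded by `B`, with `∂₂w₀ = ∂₂w₁ = 0`
everywhere (`∂₂ = D(·)(e₂)`, coordinates in the standard frame).  Then `∂₂w ≡ 0`. -/
theorem fderiv_vertical_eq_zero_of_horizontal {w : EuclideanSpace ℝ (Fin 3) → EuclideanSpace ℝ (Fin 3)}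
    (hw : ContDiff ℝ 2 w) (hdiv : VectorCalculus.IsDivFree w) {B : ℝ} (hB : ∀ y, ‖w y‖ ≤ B)
    (h0 : ∀ y, fderiv ℝ w y (EuclideanSpace.single 2 1) 0 = 0)
    (h1 : ∀ y, fderiv ℝ w y (EuclideanSpace.single 2 1) 1 = 0) :
    ∀ y, fderiv ℝ w y (EuclideanSpace.single 2 1) = 0 := by
  have hw1 : ContDiff ℝ 1 w := hw.of_le (by norm_num)
  have hwd : Differentiable ℝ w := hw1.differentiable one_ne_zero
  have hDe : ∀ e : EuclideanSpace ℝ (Fin 3), ContDiff ℝ 1 fun y => fderiv ℝ w y e := fun e =>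
    (hw.fderiv_right (m := 1) le_rfl).clm_apply contDiff_const
  have hDed : ∀ e : EuclideanSpace ℝ (Fin 3), Differentiable ℝ fun y => fderiv ℝ w y e := fun e =>
    (hDe e).differentiable one_ne_zero
  -- the vertical rate `g = ∂₂w₂` and the divergence in coordinates: `∂₀w₀ + ∂₁w₁ + g = 0`
  set g : EuclideanSpace ℝ (Fin 3) → ℝ := fun y => fderiv ℝ w y (EuclideanSpace.single 2 1) 2 with hgdef
  have hdivc : ∀ y, fderiv ℝ w y (EuclideanSpace.single 0 1) 0 + fderiv ℝ w y (EuclideanSpace.single 1 1) 1 +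
      fderiv ℝ w y (EuclideanSpace.single 2 1) 2 = 0 := by
    intro y
    have hd := hdiv y
    rw [divergence_eq_sum_inner_fderiv (EuclideanSpace.basisFun (Fin 3) ℝ)] at hd
    simpa [Fin.sum_univ_three, EuclideanSpace.basisFun_apply, EuclideanSpace.inner_single_left] using hd
  -- `g` is differentiable, with `∂₂ g = −∂₂∂₀w₀ − ∂₂∂₁w₁ = −∂₀(∂₂w₀) − ∂₁(∂₂w₁) = 0`
  have hcoordd : ∀ (e : EuclideanSpace ℝ (Fin 3)) (i : Fin 3), Differentiable ℝ fun y => fderiv ℝ w y e i :=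
    fun e i => (contDiff_apply_coord_vec3 (hDe e) i).differentiable one_ne_zero
  have hmixed : ∀ (b : Fin 3) (y : EuclideanSpace ℝ (Fin 3)),
      (∀ z, fderiv ℝ w z (EuclideanSpace.single 2 1) b = 0) →
      fderiv ℝ (fun z => fderiv ℝ w z (EuclideanSpace.single b 1) b) y (EuclideanSpace.single 2 1) = 0 := by
    intro b y hb
    rw [fderiv_apply_coord_vec3 (hDed _ y) b, fderiv_fderiv_apply_comm_vec hw y _ _,
      ← fderiv_apply_coord_vec3 (hDed _ y) b]
    have hfun : (fun z => fderiv ℝ w z (EuclideanSpace.single 2 1) b) = fun _ => (0 : ℝ) := funext hb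
    rw [hfun, fderiv_fun_const]
    rfl
  have hgd : Differentiable ℝ g := hcoordd _ 2
  have hg2 : ∀ y, fderiv ℝ g y (EuclideanSpace.single 2 1) = 0 := by
    intro y
    have hge : g = fun y => -(fderiv ℝ w y (EuclideanSpace.single 0 1) 0 + fderiv ℝ w y (EuclideanSpace.single 1 1) 1) := by
      funext y; have := hdivc y; rw [hgdef]; linarith
    rw [hge, fderiv_fun_neg, fderiv_fun_add ((hcoordd _ 0) y) ((hcoordd _ 1) y)]
    simp only [_root_.neg_apply, _root_.add_apply, hmixed 0 y h0, hmixed 1 y h1, add_zero, neg_zero]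
  -- `g` is height-independent, so `w₂` is affine along vertical lines: `w₂(y + l e₂) = w₂(y) + l g(y)`
  have hginv : ∀ (y : EuclideanSpace ℝ (Fin 3)) (l : ℝ), g (y + l • EuclideanSpace.single 2 1) = g y :=
    apply_add_smul_eq_of_fderiv_apply_eq_zero hgd hg2
  have haff : ∀ (y : EuclideanSpace ℝ (Fin 3)) (l : ℝ), w (y + l • EuclideanSpace.single 2 1) 2 = w y 2 + l * g y := by
    intro y l
    set φ : ℝ → ℝ := fun l => w (y + l • EuclideanSpace.single 2 1) 2 - l * g y with hφ
    have hline : ∀ l : ℝ, HasDerivAt (fun l : ℝ => y + l • (EuclideanSpace.single 2 1 : EuclideanSpace ℝ (Fin 3)))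
        (EuclideanSpace.single 2 1) l := fun l => by
      simpa using ((hasDerivAt_id l).smul_const (EuclideanSpace.single 2 (1 : ℝ) : EuclideanSpace ℝ (Fin 3))).const_add y
    have hw2d : Differentiable ℝ fun z => w z 2 := (contDiff_apply_coord_vec3 hw1 2).differentiable one_ne_zero
    have hd : ∀ l, HasDerivAt φ 0 l := by
      intro l
      have h1 := ((hw2d (y + l • EuclideanSpace.single 2 1)).hasFDerivAt.comp_hasDerivAt l (hline l)).sub
        ((hasDerivAt_id l).mul_const (g y))
      rw [fderiv_apply_coord_vec3 (hwd _) 2] at h1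
      have h2 : fderiv ℝ w (y + l • EuclideanSpace.single 2 1) (EuclideanSpace.single 2 1) 2 - 1 * g y = 0 := by
        rw [one_mul]
        show g (y + l • EuclideanSpace.single 2 1) - g y = 0
        rw [hginv, sub_self]
      rw [h2] at h1
      exact h1
    have hdiff : Differentiable ℝ φ := fun l => (hd l).differentiableAt
    have hconst := is_const_of_deriv_eq_zero hdiff (fun l => (hd l).deriv) l 0
    simp only [hφ, zero_smul, add_zero, zero_mul, sub_zero] at hconst
    linarith
  -- boundedness kills the slope
  have hg0 : ∀ y, g y = 0 := by
    intro y
    refine eq_zero_of_abs_add_mul_le (a := w y 2) (B := B) fun l => ?_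
    rw [← haff y l]
    exact (abs_apply_le_norm_r3 _ 2).trans (hB _)
  -- all three coordinates of `∂₂w` vanish
  intro y
  ext i
  fin_cases i
  · simpa using h0 y
  · simpa using h1 y
  · simpa [hgdef] using hg0 y

/-! ### the class: the vertically rigid germ on one slice -/

/-- **CLASS: the vertically rigid germ (`Λ = 1`, `μ = 0`) on ONE slice kills the profile.**  If on one slice `s < 0` of
a profile of the route's Type-I class the horizontal velocity has no vertical derivative on a nonempty open set,
`∂₂v₀ = ∂₂v₁ = 0` on `U`, then `v ≡ 0`. -/
theorem eq_zero_of_verticalShear_eq_zero_on_open (hrate : HasTypeITimeDecay C v)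
    (hcont : ContinuousOn (uncurry v) (Iio (0 : ℝ) ×ˢ univ))
    (hmild : ∀ s t : ℝ, s < t → t < 0 → ∀ x,
      v t x = UnboundedOperators.heatExtension (v s) (t - s) x - oseenDuhamel 1 s v v t x)
    (hdiv : ∀ t < 0, VectorCalculus.IsDivFree (v t)) {s : ℝ} (hs : s < 0)
    {U : Set (EuclideanSpace ℝ (Fin 3))} (hU : IsOpen U) (hne : U.Nonempty)
    (h : ∀ y ∈ U, fderiv ℝ (v s) y (EuclideanSpace.single 2 1) 0 = 0 ∧
      fderiv ℝ (v s) y (EuclideanSpace.single 2 1) 1 = 0) : ∀ t < 0, ∀ x, v t x = 0 := by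
  have hbdd := bdd_of_hasTypeITimeDecay hrate
  have hA : AnalyticOnNhd ℝ (v s) univ := analyticOnNhd_slice hcont hbdd hmild hs
  have hC2 : ContDiff ℝ 2 (v s) := hA.contDiff
  -- analytic spreading of the two coordinate identities
  have hD2 : AnalyticOnNhd ℝ (fun y => fderiv ℝ (v s) y (EuclideanSpace.single 2 1)) univ := by
    have hev : AnalyticOnNhd ℝ (fun p : EuclideanSpace ℝ (Fin 3) ×
        (EuclideanSpace ℝ (Fin 3) →L[ℝ] EuclideanSpace ℝ (Fin 3)) =>
        (ContinuousLinearMap.apply ℝ (EuclideanSpace ℝ (Fin 3))) p.1 p.2) univ := fun p _ =>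
      (ContinuousLinearMap.apply ℝ (EuclideanSpace ℝ (Fin 3))).analyticAt_bilinear p
    have hc : AnalyticOnNhd ℝ (fun _ : EuclideanSpace ℝ (Fin 3) =>
        (EuclideanSpace.single 2 (1 : ℝ) : EuclideanSpace ℝ (Fin 3))) univ := fun _ _ => analyticAt_const
    have h1 := hev.comp₂ hc hA.fderiv (fun x _ => mem_univ _)
    have e : (fun y => fderiv ℝ (v s) y (EuclideanSpace.single 2 1)) = fun y =>
        (ContinuousLinearMap.apply ℝ (EuclideanSpace ℝ (Fin 3))) (EuclideanSpace.single 2 1) (fderiv ℝ (v s) y) := by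
      funext y; rw [ContinuousLinearMap.apply_apply]
    rw [e]; exact h1
  have hcoord : ∀ i : Fin 3, AnalyticOnNhd ℝ (fun y => fderiv ℝ (v s) y (EuclideanSpace.single 2 1) i) univ :=
    fun i y _ => ((EuclideanSpace.proj (𝕜 := ℝ) i).analyticAt _).comp (hD2 y (mem_univ y))
  have hspread : ∀ i : Fin 3, (∀ y ∈ U, fderiv ℝ (v s) y (EuclideanSpace.single 2 1) i = 0) →
      ∀ y, fderiv ℝ (v s) y (EuclideanSpace.single 2 1) i = 0 := by
    intro i hi y
    obtain ⟨x₀, hx₀⟩ := hne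
    have hev : (fun y => fderiv ℝ (v s) y (EuclideanSpace.single 2 1) i) =ᶠ[𝓝 x₀] (fun _ => (0 : ℝ)) :=
      Filter.eventually_of_mem (hU.mem_nhds hx₀) hi
    exact congrFun ((hcoord i).eq_of_eventuallyEq (fun _ _ => analyticAt_const) hev) y
  have h0 : ∀ y, fderiv ℝ (v s) y (EuclideanSpace.single 2 1) 0 = 0 := hspread 0 fun y hy => (h y hy).1
  have h1 : ∀ y, fderiv ℝ (v s) y (EuclideanSpace.single 2 1) 1 = 0 := hspread 1 fun y hy => (h y hy).2
  -- kinematics: `∂₂ v(s) ≡ 0`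
  obtain ⟨B, hB⟩ := hbdd (-s / 2) (by linarith)
  have hB' : ∀ y, ‖v s y‖ ≤ B := fun y => hB s (by linarith) y
  have hvert := fderiv_vertical_eq_zero_of_horizontal hC2 (hdiv s hs) hB' h0 h1
  -- the slice is invariant under vertical translations
  have hd1 : Differentiable ℝ (v s) := (hA.contDiff (n := 1)).differentiable one_ne_zero
  have hinv : ∀ (y : EuclideanSpace ℝ (Fin 3)) (l : ℝ),
      v s (y + l • (EuclideanSpace.single 2 1 : EuclideanSpace ℝ (Fin 3))) = v s y := by
    intro y l
    set φ : ℝ → EuclideanSpace ℝ (Fin 3) := fun l => v s (y + l • EuclideanSpace.single 2 1) with hφ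
    have hline : ∀ l : ℝ, HasDerivAt (fun l : ℝ => y + l • (EuclideanSpace.single 2 1 : EuclideanSpace ℝ (Fin 3)))
        (EuclideanSpace.single 2 1) l := fun l => by
      simpa using ((hasDerivAt_id l).smul_const (EuclideanSpace.single 2 (1 : ℝ) : EuclideanSpace ℝ (Fin 3))).const_add y
    have hd : ∀ l, HasDerivAt φ 0 l := by
      intro l
      have h1 := (hd1 (y + l • EuclideanSpace.single 2 1)).hasFDerivAt.comp_hasDerivAt l (hline l)
      rw [hvert] at h1
      exact h1
    have hdiff : Differentiable ℝ φ := fun l => (hd l).differentiableAt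
    have hconst := is_const_of_deriv_eq_zero hdiff (fun l => (hd l).deriv) l 0
    simpa [hφ] using hconst
  have hne2 : (EuclideanSpace.single 2 1 : EuclideanSpace ℝ (Fin 3)) ≠ 0 := fun h0' => by
    simpa using congrArg (fun w : EuclideanSpace ℝ (Fin 3) => w 2) h0'
  exact eq_zero_of_translate_eq_slice hrate hcont hmild hdiv hs hne2 hinv

end Summit.NavierStokesRegularity.NavierStokesRegularity.Theorems.PoloidalWindowDoorPoloidalWindowRigidityVerticalShearGerm

end
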